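import Summits.Ventures.DiscreteObjects.Hadamard.NormalizerPrimeMain
import Summits.Ventures.DiscreteObjects.Hadamard.Frobenius83Row
import Summits.Ventures.DiscreteObjects.Hadamard.AutomorphismFixedRows668

/-!
# H(668): every automorphism normalising an element of order 83 acts on it as `±1` (kernel EXCLUSION) — the Frobenius group
# `C₈₃ ⋊ C₄₁` is not a group of signed automorphisms of a Hadamard matrix of order 668

Framing: lottery ticket; floor = certified bounds/negative ranges.

Cell pub-namedobj (venture DiscreteObjects), target (H), hadamard gen 20; the order-83 companion of `Order167Normalizer668` /
`Order167NormalizerBlocks668`.  Let `σ = (π, κ, d, e)` be a signed automorphism of a Hadamard matrix `H` of order `668` with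
`π^83 = κ^83 = 1`, `(π, κ) ≠ (1,1)` (gen-5 census `hadamard668_fixedRows_83`: exactly `4` fixed rows and `4` fixed columns, the other
`664 = 8·83` points in eight orbits), and `τ = (π', κ', d', e')` a signed automorphism with `π'π = π^μ π'`, `κ'κ = κ^μ κ'`.
* (`NormalizerPrimeMain.normalizing_prime_main` at `p = 83`): if `τ` keeps a free row `x₀` and every free column inside its `σ`-orbit,
  the eight `±1` sequences `t ↦ H' x₀ (κ^t y)` (`y` in a transversal of the free column orbits, `H'` the re-signed matrix) satisfy
  `Σ_y PAF_y(s) = −4 = −#Fix κ` for `s ≠ 0` and are translation-twisted `μ`-invariant.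
* **`paf_blk83_pm_one`**, **`inv4_of_hInvariant83`**: a `4`-invariant `±1` sequence on `ZMod 83` is a three-valued block
  (`Frobenius83Row.eq_blk83`) with `PAF(1) ∈ {−1, 79, 83}` (`decide`); a sequence invariant under a unit `u` with `u² ≠ 1` is
  `4`-invariant (`u = ±4^j`, `41 ∤ j`).
* **`hadamard668_order83_normalizer_sq_eq_one`** (block-preserving) and **`hadamard668_order83_normalizer_sq_eq_one_general`**
  (ANY normalising `τ`, via `τ^(8!)` and `NormalizerOrbitTools.norm_pow_factorial_mem_orbFin`): **`μ² ≡ 1 (mod 83)`**.  [Eight values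
  from `{−1, 79, 83}` never sum to `−4`; `μ^(2·8!) ≡ 1` and `μ^82 ≡ 1` give `μ² ≡ 1` as `gcd(2·8!, 82) = 2`.]
So: **no Hadamard matrix of order 668 has `C₈₃ ⋊ C₄₁` (or `C₈₃ ⋊ C₈₂`, or any `C₈₃ ⋊_φ C_m` with `φ` of order `> 2`) among its
signed automorphisms; an element of order 83 is centralised or inverted by whatever normalises it.**  Gen 4's design-level rows
'`Z₈₃ ⋊ Z₄₁`, `Z₈₃ ⋊ Z₈₂` with orbit lengths {1, 83}: NONE' (`no_frobenius83_row` + a paper reduction) become one matrix-level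
kernel theorem with no side condition.  EXCLUSION of a symmetry type of a hypothetical object; no Hadamard ORDER excluded; H(668)
untouched; HITS 0/4.  Ours; no `sorry`, no definitions.
-/

namespace Summit.Ventures.DiscreteObjects.Hadamard

open Finset BigOperators Matrix

open Literature.Combinatorics.Designs.GoethalsSeidel (IsHadamardMatrix)
open Literature.Combinatorics.Designs.LegendrePairs (PAF IsPM TwistedInvariant HInvariant PAF_translate)

variable {ι : Type*} [Fintype ι] [DecidableEq ι]

/-! ### number theory in `ZMod 83`: squares are powers of `4`; the `±1` square-invariant blocks -/

/-- the orbit walk of `Frobenius83Row` is the power map: `orb83 k = 4^k` -/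
lemma orb83_eq_pow (k : ℕ) : orb83 k = 4 ^ k := by
  induction k with
  | zero => rfl
  | succ k ih => show 4 * orb83 k = _; rw [ih, pow_succ']

set_option maxRecDepth 100000 in
/-- `4` has order dividing `41` in `(ℤ/83)ˣ` (it generates the non-zero squares) -/
lemma four_pow_41_zmod83 : (4 : ZMod 83) ^ 41 = 1 := by decide

/-- **a sequence on `ZMod 83` invariant under a unit `u` with `u² ≠ 1` is invariant under `4`** -/
theorem inv4_of_hInvariant83 {α : Type*} (x : ZMod 83 → α) (u : (ZMod 83)ˣ) (hsq : (u : ZMod 83) ^ 2 ≠ 1)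
    (h : ∀ i, x ((u : ZMod 83) * i) = x i) : ∀ i, x (4 * i) = x i := by
  have h41 := four_pow_41_zmod83
  have hu0 : (u : ZMod 83) ≠ 0 := fun h0 => by
    have h1 := u.mul_inv; rw [h0, zero_mul] at h1; exact absurd h1 (by decide)
  obtain ⟨j₀, hj₀⟩ : ∃ j : ℕ, (u : ZMod 83) = 4 ^ j ∨ (u : ZMod 83) = -(4 ^ j) := by
    rcases orbit_cover83 (u : ZMod 83) with h0 | ⟨-, he⟩ | ⟨-, he⟩
    · exact absurd h0 hu0
    · exact ⟨_, Or.inl (by rw [← he, orb83_eq_pow])⟩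
    · exact ⟨_, Or.inr (by rw [← orb83_eq_pow, he, neg_neg])⟩
  have husq : (u : ZMod 83) ^ 2 = 4 ^ (2 * j₀) := by
    rcases hj₀ with h1 | h1 <;> rw [h1] <;> ring
  have hj41 : ¬ 41 ∣ j₀ := by
    rintro ⟨q, rfl⟩
    apply hsq
    rw [husq, show 2 * (41 * q) = 41 * (2 * q) by ring, pow_mul, h41, one_pow]
  have hcop : Nat.Coprime (2 * j₀) 41 :=
    Nat.Coprime.mul_left (by norm_num) ((Nat.Prime.coprime_iff_not_dvd (by norm_num : Nat.Prime 41)).mpr hj41).symm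
  obtain ⟨m, -, hm⟩ := Nat.exists_mul_mod_eq_one_of_coprime hcop (by norm_num : 1 < 41)
  have h2 : ∀ i, x ((u : ZMod 83) ^ 2 * i) = x i := fun i => by rw [sq, mul_assoc, h, h]
  have hpow : ∀ k : ℕ, ∀ i, x (((u : ZMod 83) ^ 2) ^ k * i) = x i := by
    intro k; induction k with
    | zero => intro i; simp
    | succ k ih => intro i; rw [pow_succ, mul_assoc, ih, h2]
  have h4 : ((u : ZMod 83) ^ 2) ^ m = 4 := by
    have hdm := Nat.div_add_mod (2 * j₀ * m) 41
    rw [husq, ← pow_mul, show 2 * j₀ * m = 41 * (2 * j₀ * m / 41) + 1 by omega, pow_add, pow_mul, h41, one_pow,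
      one_mul, pow_one]
  intro i
  rw [← h4]; exact hpow m i

set_option maxRecDepth 100000 in
set_option maxHeartbeats 4000000 in
/-- the eight `±1` three-valued blocks on `ZMod 83` have `PAF(1) ∈ {−1, 79, 83}` (kernel evaluation) -/
theorem paf_blk83_pm_one : ∀ e0 ∈ [(1 : ℤ), -1], ∀ e1 ∈ [(1 : ℤ), -1], ∀ e2 ∈ [(1 : ℤ), -1],
    PAF (blk83 e0 e1 e2) 1 = -1 ∨ PAF (blk83 e0 e1 e2) 1 = 79 ∨ PAF (blk83 e0 e1 e2) 1 = 83 := by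
  decide

/-- `PAF(1)` of a `4`-invariant `±1` sequence on `ZMod 83` is `−1`, `79` or `83` -/
theorem paf_one_of_inv4_83 (x : ZMod 83 → ℤ) (hx : IsPM x) (hinv : ∀ i, x (4 * i) = x i) :
    PAF x 1 = -1 ∨ PAF x 1 = 79 ∨ PAF x 1 = 83 := by
  have mem : ∀ {e : ℤ}, (e = 1 ∨ e = -1) → e ∈ [(1 : ℤ), -1] := fun h => by rcases h with rfl | rfl <;> simp
  rw [eq_blk83 x hinv]
  exact paf_blk83_pm_one (x 0) (mem (hx 0)) (x 1) (mem (hx 1)) (x (-1)) (mem (hx (-1)))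

omit [Fintype ι] [DecidableEq ι] in
/-- eight square-invariant `±1` sequences on `ZMod 83` never have `Σ PAF(1) = −4` -/
lemma no_family8_qr83 {T : Finset ι} (hT8 : T.card = 8) (x : ι → ZMod 83 → ℤ) (hpm : ∀ y ∈ T, IsPM (x y))
    (hsum : ∑ y ∈ T, PAF (x y) 1 = -4) (h4 : ∀ y ∈ T, ∀ i, x y (4 * i) = x y i) : False := by
  have hval : ∀ y ∈ T, PAF (x y) 1 + 1 = 0 ∨ 80 ≤ PAF (x y) 1 + 1 := by
    intro y hy
    rcases paf_one_of_inv4_83 (x y) (hpm y hy) (h4 y hy) with h | h | h <;> rw [h] <;> norm_num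
  have hsum1 : ∑ y ∈ T, (PAF (x y) 1 + 1) = 4 := by
    rw [Finset.sum_add_distrib, hsum, Finset.sum_const, hT8]; norm_num
  have hnn : ∀ y ∈ T, 0 ≤ PAF (x y) 1 + 1 := fun y hy => by rcases hval y hy with h | h <;> omega
  by_cases hex : ∃ y ∈ T, PAF (x y) 1 + 1 ≠ 0
  · obtain ⟨y, hy, hne⟩ := hex
    have h80 : 80 ≤ PAF (x y) 1 + 1 := by
      rcases hval y hy with h | h
      · exact absurd h hne
      · exact h
    have := Finset.single_le_sum hnn hy
    omega
  · push Not at hex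
    rw [Finset.sum_eq_zero hex] at hsum1
    norm_num at hsum1

/-! ### the exclusions -/

section main
variable {H : Matrix ι ι ℤ}

/-- **EXCLUSION (order 83, block-preserving normalisers act as `±1`).**  `σ = (π, κ, d, e)` a signed automorphism of an H(668) with
`π^83 = κ^83 = 1`, `(π, κ) ≠ (1,1)`; `τ` a signed automorphism with `π'π = π^μ π'`, `κ'κ = κ^μ κ'` keeping some free row and every
free column inside its `σ`-orbit ⇒ **`μ² ≡ 1 (mod 83)`**. -/
theorem hadamard668_order83_normalizer_sq_eq_one (hH : IsHadamardMatrix H) (hι : Fintype.card ι = 668)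
    {π κ π' κ' : Equiv.Perm ι} {d e d' e' : ι → ℤ} (haut : IsSignedAut H π κ d e)
    (hπ : π ^ 83 = 1) (hκ : κ ^ 83 = 1) (hne : π ≠ 1 ∨ κ ≠ 1)
    (haut' : IsSignedAut H π' κ' d' e') {μ : ℕ} (hnπ : π' * π = π ^ μ * π') (hnκ : κ' * κ = κ ^ μ * κ')
    {x₀ : ι} (hx₀ : π x₀ ≠ x₀) (hrow : π' x₀ ∈ orbFin π 83 x₀) (hcols : ∀ y, κ y ≠ y → κ' y ∈ orbFin κ 83 y) :
    (μ : ZMod 83) ^ 2 = 1 := by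
  have h10 : (1 : ZMod 83) ≠ 0 := by decide
  by_contra hsq
  have h83 := hadamard668_fixedRows_83 hH hι π κ d e haut hπ hκ hne
  obtain ⟨u, T, x, hu, hTc, hpm, hgs, htw⟩ := normalizing_prime_main (by norm_num : Nat.Prime 83) (by decide : Odd 83)
    hH haut hπ hκ hne haut' hnπ hnκ hx₀ hrow hcols
  have hsplit := Finset.card_filter_add_card_filter_not (s := (univ : Finset ι)) (fun y => κ y = y)
  rw [h83.2, Finset.card_univ, hι] at hsplit
  have hm664 : (univ.filter fun y => ¬ κ y = y).card = 664 := by omega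
  have hm664' : (univ.filter fun y => κ y ≠ y).card = 664 := hm664
  rw [hm664'] at hTc
  have hT8 : T.card = 8 := by omega
  rw [h83.2] at hgs
  rw [← hu] at hsq
  have hu1 : (u : ZMod 83) ≠ 1 := fun h => hsq (by rw [h, one_pow])
  haveI : Fact (Nat.Prime 83) := ⟨by norm_num⟩
  have hrec : ∀ y ∈ T, ∃ δ : ZMod 83, HInvariant (Literature.Combinatorics.Designs.LegendrePairs.translate (x y) δ) u :=
    fun y hy => exists_translate_hInvariant_prime (x y) u hu1 (htw y hy)
  choose! δ hδ using hrec
  refine no_family8_qr83 hT8 (fun y => Literature.Combinatorics.Designs.LegendrePairs.translate (x y) (δ y))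
    (fun y hy r => hpm y hy _) ?_ (fun y hy => inv4_of_hInvariant83 _ u hsq (hδ y hy))
  rw [Finset.sum_congr rfl fun y _ => PAF_translate (x y) (δ y) 1]
  simpa using hgs 1 h10

/-- **EXCLUSION (order 83, general): every automorphism normalising an element of order 83 acts on it as `±1`.**  `σ` as above,
`τ` ANY signed automorphism with `π'π = π^μ π'`, `κ'κ = κ^μ κ'` ⇒ **`μ² ≡ 1 (mod 83)`**; in particular no H(668) has the Frobenius
group `C₈₃ ⋊ C₄₁` among its signed automorphisms. -/
theorem hadamard668_order83_normalizer_sq_eq_one_general (hH : IsHadamardMatrix H) (hι : Fintype.card ι = 668)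
    {π κ π' κ' : Equiv.Perm ι} {d e d' e' : ι → ℤ} (haut : IsSignedAut H π κ d e)
    (hπ : π ^ 83 = 1) (hκ : κ ^ 83 = 1) (hne : π ≠ 1 ∨ κ ≠ 1)
    (haut' : IsSignedAut H π' κ' d' e') {μ : ℕ} (hnπ : π' * π = π ^ μ * π') (hnκ : κ' * κ = κ ^ μ * κ') :
    (μ : ZMod 83) ^ 2 = 1 := by
  haveI : Fact (Nat.Prime 83) := ⟨by norm_num⟩
  have p83 : Nat.Prime 83 := by norm_num
  have h83 := hadamard668_fixedRows_83 hH hι π κ d e haut hπ hκ hne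
  -- transversals (8 orbits on each side) and the 8!-th power of τ
  have hfree : ∀ (ρ : Equiv.Perm ι), ρ ^ 83 = 1 → ∀ y, ρ y ≠ y → ∀ k, 0 < k → k < 83 → (ρ ^ k) y ≠ y :=
    fun ρ hρ y hy => free_of_fixed_prime_pow ρ p83 (by rw [hρ, Equiv.Perm.one_apply]) hy
  have htrans : ∀ (ρ : Equiv.Perm ι), ρ ^ 83 = 1 → (univ.filter fun y => ρ y = y).card = 4 →
      ∃ T : Finset ι, T ⊆ univ.filter (fun y => ρ y ≠ y) ∧ T.card = 8 ∧
        ∀ f : ι → ℤ, ∑ y ∈ univ.filter (fun y => ρ y ≠ y), f y = ∑ t ∈ T, ∑ k ∈ Finset.range 83, f ((ρ ^ k) t) := by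
    intro ρ hρ hfix
    have hstab : ∀ y ∈ univ.filter (fun y => ρ y ≠ y), ρ y ∈ univ.filter (fun y => ρ y ≠ y) := by
      intro y hy; rw [Finset.mem_filter] at hy ⊢; exact ⟨Finset.mem_univ _, fun h => hy.2 (ρ.injective h)⟩
    obtain ⟨T, hTsub, hTc, hT⟩ := exists_free_transversal ρ (by norm_num : 0 < 83) _ (univ.filter fun y => ρ y ≠ y) le_rfl
      hstab (fun y _ => by rw [hρ, Equiv.Perm.one_apply]) (fun y hy => hfree ρ hρ y (Finset.mem_filter.mp hy).2)
    have hsplit := Finset.card_filter_add_card_filter_not (s := (univ : Finset ι)) (fun y => ρ y = y)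
    rw [hfix, Finset.card_univ, hι] at hsplit
    have hm : (univ.filter fun y => ¬ ρ y = y).card = 664 := by omega
    have hm' : (univ.filter fun y => ρ y ≠ y).card = 664 := hm
    rw [hm'] at hTc
    exact ⟨T, hTsub, by omega, hT⟩
  have hne1 : ∀ (ρ : Equiv.Perm ι), (univ.filter fun y => ρ y = y).card = 4 → ρ ≠ 1 := by
    intro ρ hfix h1
    have : (univ.filter fun y => ρ y = y) = univ := Finset.filter_true_of_mem fun y _ => by rw [h1, Equiv.Perm.one_apply]
    rw [this, Finset.card_univ, hι] at hfix
    norm_num at hfix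
  obtain ⟨TR, hTRsub, hTR8, hTR⟩ := htrans π hπ h83.1
  obtain ⟨TC, hTCsub, hTC8, hTC⟩ := htrans κ hκ h83.2
  have hrows := norm_pow_factorial_mem_orbFin p83 hnπ hπ (hne1 π h83.1) TR hTRsub hTR
  have hcolsF := norm_pow_factorial_mem_orbFin p83 hnκ hκ (hne1 κ h83.2) TC hTCsub hTC
  rw [hTR8] at hrows; rw [hTC8] at hcolsF
  -- a free row exists
  obtain ⟨x₀, hx₀T⟩ : TR.Nonempty := Finset.card_pos.mp (by rw [hTR8]; norm_num)
  have hx₀ : π x₀ ≠ x₀ := (Finset.mem_filter.mp (hTRsub hx₀T)).2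
  have hbig := hadamard668_order83_normalizer_sq_eq_one hH hι haut hπ hκ hne (isSignedAut_pow haut' (Nat.factorial 8))
    (norm_pow_left hnπ _) (norm_pow_left hnκ _) hx₀ (hrows x₀ hx₀) hcolsF
  push_cast at hbig
  rw [← pow_mul, show Nat.factorial 8 = 40320 by rfl] at hbig
  -- μ ≠ 0 in ZMod 83
  have hμ0 : (μ : ZMod 83) ≠ 0 := by
    intro h0
    rw [ZMod.natCast_eq_zero_iff] at h0
    obtain ⟨m, rfl⟩ := h0
    have h1 := hnκ
    rw [pow_mul, hκ, one_pow, one_mul] at h1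
    have h2 : κ' * κ = κ' * 1 := by rw [h1, mul_one]
    have h3 : κ = 1 := mul_left_cancel h2
    have h1' := hnπ
    rw [pow_mul, hπ, one_pow, one_mul] at h1'
    have h2' : π' * π = π' * 1 := by rw [h1', mul_one]
    have h3' : π = 1 := mul_left_cancel h2'
    rcases hne with h | h
    · exact h h3'
    · exact h h3
  have h82 : (μ : ZMod 83) ^ 82 = 1 := ZMod.pow_card_sub_one_eq_one hμ0
  calc (μ : ZMod 83) ^ 2 = (μ : ZMod 83) ^ 2 * ((μ : ZMod 83) ^ (40320 * 2)) ^ 12 := by rw [hbig, one_pow, mul_one]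
    _ = ((μ : ZMod 83) ^ 82) ^ 11801 := by ring
    _ = 1 := by rw [h82, one_pow]

end main

end Summit.Ventures.DiscreteObjects.Hadamard
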